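import Summits.HodgeConjecture.HodgeConjecture.Theses.DeltaPeriodAudit

/-!
# Route DeltaPeriodAudit — `Assembly` (assembly item stmt-HodgeConjecture-2369)

The assembly item of route `DeltaPeriodAudit`,

  HodgeForcesNewformPeriodRatioIrrational → RationalNewformPeriodRatio → ¬ HodgeConjecture,

is pure logic: `HodgeForcesNewformPeriodRatioIrrational` says that the Hodge conjecture forces the
squared ratio of two critical imaginary-axis periods (of opposite parity) of a non-CM rational newform
of weight `≥ 3` to be irrational, while `RationalNewformPeriodRatio` exhibits such a newform and such a
pair of periods whose squared ratio is a rational number `q`; the two are incompatible with the Hodge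
conjecture.  No other import, no named-fact hypothesis, no sorry.
-/

-- `Summit.HodgeConjecture.HodgeConjecture.Theorems` is the mandated namespace (single-problem
-- summit: Problem = Summit), which `linter.dupNamespace` flags on every declaration; the lakefile
-- turns the linter off tree-wide (weak option), restated here so stand-alone elaboration is
-- warning-free too.
set_option linter.dupNamespace false

namespace Summit.HodgeConjecture.HodgeConjecture.Theorems

/-- **Item stmt-HodgeConjecture-2369 (`Assembly`), route `DeltaPeriodAudit`**: if the Hodge conjecture
forces the squared period ratios of non-CM rational newforms (weight `≥ 3`, opposite parities) to be
irrational, and some such squared ratio is rational, then the Hodge conjecture fails — instantiate the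
first hypothesis at the witness of the second and observe that a rational real number is not
irrational.  The type is the route decl
`Summit.HodgeConjecture.HodgeConjecture.Theses.DeltaPeriodAudit.Assembly`. -/
theorem deltaPeriodAudit_assembly_proof :
    Summit.HodgeConjecture.HodgeConjecture.Theses.DeltaPeriodAudit.Assembly := by
  intro h1 h2 hHC
  obtain ⟨N, hN, k, f, a, b, q, hk, hnew, hfield, hnotwist, ha, hb, hodd, hIa, hIb, hq⟩ := h2
  have hirr := h1 hHC N k f hk hnew hfield hnotwist a b ha hb hodd hIa hIb
  rw [hq] at hirr
  exact hirr (Set.mem_range_self q)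

end Summit.HodgeConjecture.HodgeConjecture.Theorems
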